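import Mathlib
import Summits.ValiantsHypothesis.ValiantsHypothesis.Theorems.NewtonUnitEquationsNewtonTauWeakK3PaperRayLemma

/-!
# `NewtonTauWeak` (stmt-ValiantsHypothesis-5904), sub-stub `fixedKCoincidence_t2_K3`: the DEEP LEMMA
# (two products at the corner, the third product at their first ray point, double cancellation)

Support file for the crux `Summit.ValiantsHypothesis.ValiantsHypothesis.Theses.NewtonUnitEquations.NewtonTauWeak`;
this is case (b) of `Cruxes/NewtonTauWeak/Lines/binomial-normal-form-ltc.md` §5 ("two products at the corner, the
third higher … omitted here, to be done with the formalisation"), written out and proved.  LOCAL MODEL (after the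
flip identity and division by one of the two corner products): `(Π A − 1) − a·X^{r}·Π B` with `r = o₁E_{e₁}` the
order point of the `w`-lightest active direction `e₁` of `A` (the initial exponent of `Π A − 1` by the ray
lemma) and `a ≠ 0` (the corner of the third product sits at `r` and its corner coefficient cancels the
coefficient `a` of `X^r`).  THEOREM (`deep_lemma`, anchor `k3p_deep_lemma`): if an OFF-ray point `v ≠ 0`
carries a nonzero coefficient while every lighter nonzero point is cancelled, then `v = o₁E_{e₁} + β E_{e'}`
with `β` the corner ORDER of `B_{e'}` at a direction `e' ≠ e₁`, unless that point lies on a ray (escape clause,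
void under "no short 2-vs-1 relations").  Proof: every off-ray contributing point is reached by a mixed
`A`-word (weight `≥ W_A = o₁w₁ + o₂w₂`, `weight_ge_two_lightest`) or by `r +` a `B`-word with a letter
`≠ e₁` (weight `≥ W_B = o₁w₁ + β'w'`); the pure point `o₂E_{e₂}` is uncancelled (coefficient `a₂`) unless
`B` reaches below it, which forces `W_B ≤ o₂w₂ < W_A`; at `q_B = r + β'E_{e'}` the coefficient is `−a b' ≠ 0`
unless a mixed `A`-word reaches it (`W_A ≤ W_B`); comparing thresholds leaves only `v = q_B`.
No definitions. [new for this line]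
-/

-- the namespace mandated for this Theorems file repeats the component `ValiantsHypothesis`
set_option linter.dupNamespace false

noncomputable section

open scoped BigOperators Polynomial
open Summit.ValiantsHypothesis.ValiantsHypothesis.Theorems.NewtonTauWeakCorner

namespace Summit.ValiantsHypothesis.ValiantsHypothesis.Theorems.NewtonTauWeakK3Paper

/-! ## The deep lemma (two products at the corner, the third at the first ray point, double cancellation) -/

/-- A word with at most one nonzero letter, that letter being `e₁` (or none), is a pure `e₁`-power.
[folklore] -/
theorem eq_single_of_forall_eq_zero {s : ℕ} (m : Fin s → ℕ) (e₁ : Fin s) (h : ∀ e, e ≠ e₁ → m e = 0) :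
    m = Pi.single e₁ (m e₁) := by
  funext x
  by_cases hx : x = e₁
  · subst hx; simp
  · simp [hx, h x hx]

/-- **Deep lemma (two-plus-one).** Local model `(Π A − 1) − a·X^{r}·Π B` with `r = o₁E_{e₁}` the order
point of the `w`-lightest active direction `e₁` of `A` and `a ≠ 0` (the configuration at a corner shared by
two products whose first ray point is the corner of the third product, after both cancellations).  If an
OFF-ray point `v ≠ 0` carries a nonzero coefficient while every lighter nonzero point is cancelled, then
`v = o₁E_{e₁} + β E_{e'}` with `β` the ORDER of `B_{e'}` at a direction `e' ≠ e₁`, unless that point is on a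
ray (escape clause, void under "no short 2-vs-1 relations"). [new for this line; the omitted case (b) of
`Cruxes/NewtonTauWeak/Lines/binomial-normal-form-ltc.md` §5] -/
theorem deep_lemma {s D : ℕ} (E : Fin s → Fin 2 → ℤ) (w : Fin 2 → ℝ)
    (hw : ∀ e, 0 < wt w (E e)) (hgen : Function.Injective (wt w))
    (hE : ∀ e e' : Fin s, ∀ k k' : ℕ, 1 ≤ k → (k : ℤ) • E e = (k' : ℤ) • E e' → e = e')
    (A B : Fin s → ℂ[X]) (hA0 : ∀ e, (A e).coeff 0 = 1) (hB0 : ∀ e, (B e).coeff 0 = 1)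
    (hAD : ∀ e, (A e).natDegree ≤ D) (hBD : ∀ e, (B e).natDegree ≤ D)
    (oA oB : Fin s → ℕ) (hoA : ∀ e, Active (A e) → IsOrder (A e) (oA e))
    (hoB : ∀ e, Active (B e) → IsOrder (B e) (oB e))
    (e₁ : Fin s) (hA1 : Active (A e₁))
    (h1min : ∀ e, Active (A e) → (oA e₁ : ℝ) * wt w (E e₁) ≤ (oA e : ℝ) * wt w (E e))
    (a : ℂ) (ha : a ≠ 0)
    (v : Fin 2 → ℤ) (hv0 : v ≠ 0) (hoff : ¬ OnRay E v)
    (hv : fibreSum E D 1 0 A A v - a * fibreSum E D 1 0 B B (v - (oA e₁ : ℤ) • E e₁) ≠ 0)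
    (hcanc : ∀ z, z ≠ 0 → wt w z < wt w v →
      fibreSum E D 1 0 A A z - a * fibreSum E D 1 0 B B (z - (oA e₁ : ℤ) • E e₁) = 0) :
    ∃ e' : Fin s, e' ≠ e₁ ∧ Active (B e') ∧
      (v = (oA e₁ : ℤ) • E e₁ + (oB e' : ℤ) • E e' ∨ OnRay E ((oA e₁ : ℤ) • E e₁ + (oB e' : ℤ) • E e')) := by
  classical
  -- notation and basic weights
  set r : Fin 2 → ℤ := (oA e₁ : ℤ) • E e₁ with hr
  set wr : ℝ := (oA e₁ : ℝ) * wt w (E e₁) with hwr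
  have ho1 := hoA e₁ hA1
  have hwtr : wt w r = wr := by rw [hr, wt_zsmul]; push_cast; ring
  have hwrpos : 0 < wr := mul_pos (by exact_mod_cast ho1.1) (hw e₁)
  -- contrapositive of the cancellation hypothesis
  have hle_of_ne : ∀ z, z ≠ 0 →
      fibreSum E D 1 0 A A z - a * fibreSum E D 1 0 B B (z - r) ≠ 0 → wt w v ≤ wt w z := by
    intro z hz hne
    by_contra hlt
    push Not at hlt
    exact hne (hcanc z hz hlt)
  -- words with only `e₁`-letters push `v - r`-type equations onto the ray `e₁`
  have pure_e1 : ∀ m : Fin s → ℕ, (∀ e, e ≠ e₁ → m e = 0) → push E m = (m e₁ : ℤ) • E e₁ := by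
    intro m hm
    rw [eq_single_of_forall_eq_zero m e₁ hm, push_single]
    simp
  -- (F4) the `B`-side letter bound relative to the lightest active direction `e' ≠ e₁` of `B`
  set AB := Finset.univ.filter fun e => e ≠ e₁ ∧ Active (B e) with hAB
  have F4 : ∀ (e' : Fin s), e' ∈ AB → (∀ e ∈ AB, (oB e' : ℝ) * wt w (E e') ≤ (oB e : ℝ) * wt w (E e)) →
      ∀ m : Fin s → ℕ, sepCoeff B m ≠ 0 → ∀ e, e ≠ e₁ → m e ≠ 0 →
      (oB e' : ℝ) * wt w (E e') ≤ wt w (push E m) ∧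
      ((oB e' : ℝ) * wt w (E e') = wt w (push E m) → m = Pi.single e' (oB e')) := by
    intro e' he' hmin m hsm e hee hme
    have hPe := sepCoeff_ne_zero_apply hsm e
    have hAe : Active (B e) := active_of_coeff_ne_zero (Nat.one_le_iff_ne_zero.mpr hme) hPe
    have heAB : e ∈ AB := Finset.mem_filter.mpr ⟨Finset.mem_univ e, hee, hAe⟩
    have hlb := letter_bound E w hw B oB hoB m e hme hPe
    have h1 := hmin e heAB
    refine ⟨h1.trans hlb.1, fun heq => ?_⟩
    have heq' : (oB e : ℝ) * wt w (E e) = wt w (push E m) := le_antisymm hlb.1 (by rw [← heq]; exact h1)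
    have hm := hlb.2 heq'
    have hval : (oB e : ℝ) * wt w (E e) = (oB e' : ℝ) * wt w (E e') := by linarith
    have hee' : e = e' := by
      have h' : wt w ((oB e : ℤ) • E e) = wt w ((oB e' : ℤ) • E e') := by
        rw [wt_zsmul, wt_zsmul]; push_cast; exact hval
      exact hE e e' (oB e) (oB e') (hoB e hAe).1 (hgen h')
    subst hee'
    exact hm
  -- (FACT β) at the lightest `B`-point `q_B = r + oB(e') E_{e'}`: the `B`-fibre is the order coefficient
  have factβB : ∀ (e' : Fin s), e' ∈ AB → (∀ e ∈ AB, (oB e' : ℝ) * wt w (E e') ≤ (oB e : ℝ) * wt w (E e)) →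
      fibreSum E D 1 0 B B ((oB e' : ℤ) • E e') = (B e').coeff (oB e') := by
    intro e' he' hmin
    have hAe' : Active (B e') := (Finset.mem_filter.mp he').2.2
    have hoe' := hoB e' hAe'
    rw [fibreSum_pure E w hw hE 1 0 B B hB0 hB0 e' (oB e') hoe'.1 (hoe'.le_natDegree.trans (hBD e'))]
    · ring
    · intro m _ h2 hsm
      have hsm' : sepCoeff B m ≠ 0 := by rcases hsm with h | h <;> exact h
      -- a word with two letters has a letter `≠ e₁`
      obtain ⟨x, hx, y, hy, hxy⟩ := Finset.one_lt_card.mp (by omega : 1 < (Finset.univ.filter fun x => m x ≠ 0).card)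
      have hx' := (Finset.mem_filter.mp hx).2
      have hy' := (Finset.mem_filter.mp hy).2
      obtain ⟨e, hee, hme⟩ : ∃ e, e ≠ e₁ ∧ m e ≠ 0 := by
        by_cases hxe : x = e₁
        · exact ⟨y, fun h => hxy (by rw [hxe, h]), hy'⟩
        · exact ⟨x, hxe, hx'⟩
      have hF := F4 e' he' hmin m hsm' e hee hme
      rw [wt_zsmul]; push_cast
      refine lt_of_le_of_ne hF.1 fun heq => ?_
      have hm := hF.2 heq
      -- a pure word has one letter: contradiction with two letters
      rw [hm] at hx' hy'
      apply hxy
      have hx1 : x = e' := by by_contra h; exact hx' (by simp [h])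
      have hy1 : y = e' := by by_contra h; exact hy' (by simp [h])
      rw [hx1, hy1]
  -- (FACT α) decomposition of the nonzero coefficient at `v`
  have factα : (∃ n ∈ box s D, push E n = v ∧ sepCoeff A n ≠ 0 ∧ 2 ≤ (Finset.univ.filter fun x => n x ≠ 0).card) ∨
      (∃ m ∈ box s D, push E m = v - r ∧ sepCoeff B m ≠ 0 ∧ ∃ e, e ≠ e₁ ∧ m e ≠ 0) := by
    by_cases hAv : fibreSum E D 1 0 A A v ≠ 0
    · left
      obtain ⟨n, hnbox, hpush, hsep⟩ := exists_word_of_fibreSum_ne_zero E A hAv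
      exact ⟨n, hnbox, hpush, hsep, two_le_card_of_offRay E hpush hv0 hoff⟩
    · right
      push Not at hAv
      have hBv : fibreSum E D 1 0 B B (v - r) ≠ 0 := by
        intro h; apply hv; rw [hAv, h]; ring
      obtain ⟨m, hmbox, hpush, hsep⟩ := exists_word_of_fibreSum_ne_zero E B hBv
      refine ⟨m, hmbox, hpush, hsep, ?_⟩
      by_contra hall
      push Not at hall
      have hpm := pure_e1 m hall
      apply hoff
      refine ⟨e₁, m e₁ + oA e₁, by have := ho1.1; omega, ?_⟩
      have : v = push E m + r := by rw [hpush]; abel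
      rw [this, hpm, hr, ← add_smul]
      norm_cast
  -- the `A`-side second direction and mixed threshold, when they exist
  set AA := Finset.univ.filter fun e => e ≠ e₁ ∧ Active (A e) with hAA
  -- (FACT γ) if `A` has a second active direction `e₂` (lightest among those `≠ e₁`), the point
  -- `p₂ = oA(e₂) E_{e₂}` is an uncancelled light point unless `B` reaches below it
  have factγ : ∀ e₂ ∈ AA, (∀ e ∈ AA, (oA e₂ : ℝ) * wt w (E e₂) ≤ (oA e : ℝ) * wt w (E e)) →
      (∃ e' ∈ AB, (oB e' : ℝ) * wt w (E e') + wr ≤ (oA e₂ : ℝ) * wt w (E e₂)) ∨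
        wt w v ≤ (oA e₂ : ℝ) * wt w (E e₂) := by
    intro e₂ he2 h2min
    obtain ⟨hne2, hA2⟩ := (Finset.mem_filter.mp he2).2
    have ho2 := hoA e₂ hA2
    have h2min' : ∀ e, e ≠ e₁ → Active (A e) → (oA e₂ : ℝ) * wt w (E e₂) ≤ (oA e : ℝ) * wt w (E e) :=
      fun e hee hAe => h2min e (Finset.mem_filter.mpr ⟨Finset.mem_univ e, hee, hAe⟩)
    have hGB := weight_ge_two_lightest E w hw hgen hE A oA hoA e₁ e₂ (Ne.symm hne2) hA2 h1min h2min'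
    set p₂ : Fin 2 → ℤ := (oA e₂ : ℤ) • E e₂ with hp2
    have hwt2 : wt w p₂ = (oA e₂ : ℝ) * wt w (E e₂) := by rw [hp2, wt_zsmul]; push_cast; ring
    have hw2pos : 0 < (oA e₂ : ℝ) * wt w (E e₂) := mul_pos (by exact_mod_cast ho2.1) (hw e₂)
    have hp2ne : p₂ ≠ 0 := by
      intro h; have := congrArg (wt w) h; rw [hwt2, wt_zero] at this; linarith
    -- the `A`-fibre at `p₂`
    have hAp2 : fibreSum E D 1 0 A A p₂ = (A e₂).coeff (oA e₂) := by
      rw [hp2, fibreSum_pure E w hw hE 1 0 A A hA0 hA0 e₂ (oA e₂) ho2.1 (ho2.le_natDegree.trans (hAD e₂))]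
      · ring
      · intro n _ h2 hsn
        have hsn' : sepCoeff A n ≠ 0 := by rcases hsn with h | h <;> exact h
        have := (hGB n h2 hsn').1
        rw [wt_zsmul]; push_cast
        linarith
    by_cases hBp2 : fibreSum E D 1 0 B B (p₂ - r) = 0
    · right
      rw [← hwt2]
      apply hle_of_ne p₂ hp2ne
      rw [hAp2, hBp2, mul_zero, sub_zero]
      exact ho2.2.1
    · left
      obtain ⟨m, hmbox, hpush, hsep⟩ := exists_word_of_fibreSum_ne_zero E B hBp2
      -- `m` has a letter `≠ e₁`
      obtain ⟨e, hee, hme⟩ : ∃ e, e ≠ e₁ ∧ m e ≠ 0 := by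
        by_contra hall
        push Not at hall
        have hpm := pure_e1 m hall
        rw [hpm] at hpush
        have : ((m e₁ + oA e₁ : ℕ) : ℤ) • E e₁ = (oA e₂ : ℤ) • E e₂ := by
          push_cast
          rw [add_smul, hpush, hp2, hr]; abel
        exact hne2 (hE e₁ e₂ (m e₁ + oA e₁) (oA e₂) (by have := ho1.1; omega) this).symm
      have hAe : Active (B e) :=
        active_of_coeff_ne_zero (Nat.one_le_iff_ne_zero.mpr hme) (sepCoeff_ne_zero_apply hsep e)
      have heAB : e ∈ AB := Finset.mem_filter.mpr ⟨Finset.mem_univ e, hee, hAe⟩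
      obtain ⟨e', he', hmin⟩ := AB.exists_min_image (fun e => (oB e : ℝ) * wt w (E e)) ⟨e, heAB⟩
      refine ⟨e', he', ?_⟩
      have hF := (F4 e' he' hmin m hsep e hee hme).1
      have : wt w (push E m) = (oA e₂ : ℝ) * wt w (E e₂) - wr := by
        rw [hpush, hp2]
        rw [show (oA e₂ : ℤ) • E e₂ - r = (oA e₂ : ℤ) • E e₂ + (-r) from sub_eq_add_neg _ _, wt_add, wt_zsmul]
        have : wt w (-r) = - wt w r := by simp [wt]; ring
        rw [this, hwtr]; push_cast; ring
      linarith
  -- (FACT β) full: at `q_B` the coefficient is `-a b'` provided the `A`-side does not reach it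
  have factβ : ∀ (e' : Fin s), e' ∈ AB → (∀ e ∈ AB, (oB e' : ℝ) * wt w (E e') ≤ (oB e : ℝ) * wt w (E e)) →
      ¬ OnRay E (r + (oB e' : ℤ) • E e') →
      (∀ n ∈ box s D, push E n = r + (oB e' : ℤ) • E e' → sepCoeff A n ≠ 0 →
        2 ≤ (Finset.univ.filter fun x => n x ≠ 0).card → False) →
      wt w v ≤ wr + (oB e' : ℝ) * wt w (E e') := by
    intro e' he' hmin hray hnoA
    have hAe' : Active (B e') := (Finset.mem_filter.mp he').2.2
    have hoe' := hoB e' hAe'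
    set q : Fin 2 → ℤ := r + (oB e' : ℤ) • E e' with hq
    have hwtq : wt w q = wr + (oB e' : ℝ) * wt w (E e') := by
      rw [hq, wt_add, hwtr, wt_zsmul]; push_cast; ring
    have hqpos : 0 < wt w q := by
      rw [hwtq]
      have : 0 < (oB e' : ℝ) * wt w (E e') := mul_pos (by exact_mod_cast hoe'.1) (hw e')
      linarith
    have hqne : q ≠ 0 := by
      intro h; have := congrArg (wt w) h; rw [wt_zero] at this; linarith
    -- the `A`-fibre at `q` vanishes
    have hAq : fibreSum E D 1 0 A A q = 0 := by
      by_contra hne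
      obtain ⟨n, hnbox, hpush, hsep⟩ := exists_word_of_fibreSum_ne_zero E A hne
      by_cases h2 : 2 ≤ (Finset.univ.filter fun x => n x ≠ 0).card
      · exact hnoA n hnbox hpush hsep h2
      · rcases eq_zero_or_single_of_card_le_one n (by omega) with h0 | ⟨e, k, hk, hn⟩
        · rw [h0, push_zero] at hpush
          exact hqne hpush.symm
        · rw [hn, push_single] at hpush
          exact hray ⟨e, k, hk, hpush.symm⟩
    -- the `B`-fibre at `q - r` is the order coefficient
    have hBq : fibreSum E D 1 0 B B (q - r) = (B e').coeff (oB e') := by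
      have : q - r = (oB e' : ℤ) • E e' := by rw [hq]; abel
      rw [this]
      exact factβB e' he' hmin
    rw [← hwtq]
    apply hle_of_ne q hqne
    rw [hAq, hBq, zero_sub, neg_ne_zero]
    exact mul_ne_zero ha hoe'.2.1
  -- MAIN CASE ANALYSIS
  rcases factα with ⟨n, hnbox, hpushn, hsepn, h2n⟩ | ⟨m, hmbox, hpushm, hsepm, e, hee, hme⟩
  · -- case A: `v` is reached by a mixed `A`-word; then `A` has a second active direction
    obtain ⟨x, hx, y, hy, hxy⟩ := Finset.one_lt_card.mp (by omega : 1 < (Finset.univ.filter fun x => n x ≠ 0).card)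
    have hx' := (Finset.mem_filter.mp hx).2
    have hy' := (Finset.mem_filter.mp hy).2
    obtain ⟨e₂', he₂ne, hne₂'⟩ : ∃ e, e ≠ e₁ ∧ n e ≠ 0 := by
      by_cases hxe : x = e₁
      · exact ⟨y, fun h => hxy (by rw [hxe, h]), hy'⟩
      · exact ⟨x, hxe, hx'⟩
    have hA2' : Active (A e₂') := active_of_coeff_ne_zero (Nat.one_le_iff_ne_zero.mpr hne₂')
      (sepCoeff_ne_zero_apply hsepn e₂')
    have hAAne : AA.Nonempty := ⟨e₂', Finset.mem_filter.mpr ⟨Finset.mem_univ _, he₂ne, hA2'⟩⟩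
    obtain ⟨e₂, he2, h2min⟩ := AA.exists_min_image (fun e => (oA e : ℝ) * wt w (E e)) hAAne
    obtain ⟨hne2, hA2⟩ := (Finset.mem_filter.mp he2).2
    have h2min' : ∀ e, e ≠ e₁ → Active (A e) → (oA e₂ : ℝ) * wt w (E e₂) ≤ (oA e : ℝ) * wt w (E e) :=
      fun e hee hAe => h2min e (Finset.mem_filter.mpr ⟨Finset.mem_univ e, hee, hAe⟩)
    have hGB := weight_ge_two_lightest E w hw hgen hE A oA hoA e₁ e₂ (Ne.symm hne2) hA2 h1min h2min'
    -- `W_A ≤ wt v`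
    have hWAv : wr + (oA e₂ : ℝ) * wt w (E e₂) ≤ wt w v := by
      have := (hGB n h2n hsepn).1
      rw [hpushn] at this
      exact this
    -- FACT γ
    rcases factγ e₂ he2 h2min with ⟨e', he', hWB⟩ | hvle
    · -- `B` reaches below `p₂`: then FACT β contradicts
      obtain ⟨e'', he'', hmin⟩ := AB.exists_min_image (fun e => (oB e : ℝ) * wt w (E e)) ⟨e', he'⟩
      have hAe'' : Active (B e'') := (Finset.mem_filter.mp he'').2.2
      have hne'' : e'' ≠ e₁ := (Finset.mem_filter.mp he'').2.1
      by_cases hray : OnRay E (r + (oB e'' : ℤ) • E e'')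
      · exact ⟨e'', hne'', hAe'', Or.inr hray⟩
      · exfalso
        have hWB'' : (oB e'' : ℝ) * wt w (E e'') + wr ≤ (oA e₂ : ℝ) * wt w (E e₂) := by
          have := hmin e' he'; linarith
        have hβ := factβ e'' he'' hmin hray (by
          intro n' hn'box hpush' hsep' h2'
          have := (hGB n' h2' hsep').1
          rw [hpush', wt_add, hwtr, wt_zsmul] at this
          push_cast at this
          linarith)
        linarith
    · -- `wt v ≤ w₂ < W_A ≤ wt v`
      exfalso
      linarith
  · -- case B: `v - r` is reached by a `B`-word with a letter `≠ e₁`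
    have hAe : Active (B e) :=
      active_of_coeff_ne_zero (Nat.one_le_iff_ne_zero.mpr hme) (sepCoeff_ne_zero_apply hsepm e)
    have heAB : e ∈ AB := Finset.mem_filter.mpr ⟨Finset.mem_univ e, hee, hAe⟩
    obtain ⟨e', he', hmin⟩ := AB.exists_min_image (fun e => (oB e : ℝ) * wt w (E e)) ⟨e, heAB⟩
    have hAe' : Active (B e') := (Finset.mem_filter.mp he').2.2
    have hne' : e' ≠ e₁ := (Finset.mem_filter.mp he').2.1
    have hF := F4 e' he' hmin m hsepm e hee hme
    have hwtvm : wt w v = wr + wt w (push E m) := by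
      have : v = r + push E m := by rw [hpushm]; abel
      rw [this, wt_add, hwtr]
    -- `W_B ≤ wt v`
    have hWBv : wr + (oB e' : ℝ) * wt w (E e') ≤ wt w v := by rw [hwtvm]; linarith [hF.1]
    by_cases hray : OnRay E (r + (oB e' : ℤ) • E e')
    · exact ⟨e', hne', hAe', Or.inr hray⟩
    -- is there a second active direction of `A` with `W_A ≤ W_B`?
    by_cases hAcase : ∃ e₂ ∈ AA, (∀ e ∈ AA, (oA e₂ : ℝ) * wt w (E e₂) ≤ (oA e : ℝ) * wt w (E e)) ∧
        wr + (oA e₂ : ℝ) * wt w (E e₂) ≤ wr + (oB e' : ℝ) * wt w (E e')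
    · exfalso
      obtain ⟨e₂, he2, h2min, hWAB⟩ := hAcase
      rcases factγ e₂ he2 h2min with ⟨f, hf, hWB⟩ | hvle
      · have := hmin f hf
        have hw2pos : 0 < wr := hwrpos
        linarith
      · have ho2 := hoA e₂ (Finset.mem_filter.mp he2).2.2
        linarith
    · -- no: the `A`-side does not reach `q_B`; FACT β gives `wt v ≤ W_B`, so equality and `v = q_B`
      have hβ := factβ e' he' hmin hray (by
        intro n' hn'box hpush' hsep' h2'
        -- a mixed `A`-word at `q_B`: then `A` has a second active direction and `W_A ≤ W_B`
        obtain ⟨x, hx, y, hy, hxy⟩ := Finset.one_lt_card.mp (by omega : 1 < (Finset.univ.filter fun x => n' x ≠ 0).card)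
        have hx' := (Finset.mem_filter.mp hx).2
        have hy' := (Finset.mem_filter.mp hy).2
        obtain ⟨f, hfne, hnf⟩ : ∃ e, e ≠ e₁ ∧ n' e ≠ 0 := by
          by_cases hxe : x = e₁
          · exact ⟨y, fun h => hxy (by rw [hxe, h]), hy'⟩
          · exact ⟨x, hxe, hx'⟩
        have hAf : Active (A f) := active_of_coeff_ne_zero (Nat.one_le_iff_ne_zero.mpr hnf)
          (sepCoeff_ne_zero_apply hsep' f)
        have hAAne : AA.Nonempty := ⟨f, Finset.mem_filter.mpr ⟨Finset.mem_univ _, hfne, hAf⟩⟩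
        obtain ⟨e₂, he2, h2min⟩ := AA.exists_min_image (fun e => (oA e : ℝ) * wt w (E e)) hAAne
        obtain ⟨hne2, hA2⟩ := (Finset.mem_filter.mp he2).2
        have h2min' : ∀ e, e ≠ e₁ → Active (A e) → (oA e₂ : ℝ) * wt w (E e₂) ≤ (oA e : ℝ) * wt w (E e) :=
          fun e hee hAe => h2min e (Finset.mem_filter.mpr ⟨Finset.mem_univ e, hee, hAe⟩)
        have hGB := weight_ge_two_lightest E w hw hgen hE A oA hoA e₁ e₂ (Ne.symm hne2) hA2 h1min h2min'
        have := (hGB n' h2' hsep').1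
        rw [hpush', wt_add, hwtr, wt_zsmul] at this
        push_cast at this
        exact hAcase ⟨e₂, he2, h2min, by linarith⟩)
      have heq : (oB e' : ℝ) * wt w (E e') = wt w (push E m) := by linarith
      have hm := hF.2 heq
      refine ⟨e', hne', hAe', Or.inl ?_⟩
      have : v = r + push E m := by rw [hpushm]; abel
      rw [this, hm, push_single]

/-- ANCHOR (registered helper stub): the deep lemma, see `deep_lemma`. [new for this line] -/
theorem k3p_deep_lemma {s D : ℕ} (E : Fin s → Fin 2 → ℤ) (w : Fin 2 → ℝ) (hw : ∀ e, 0 < wt w (E e)) (hgen : Function.Injective (wt w)) (hE : ∀ e e' : Fin s, ∀ k k' : ℕ, 1 ≤ k → (k : ℤ) • E e = (k' : ℤ) • E e' → e = e') (A B : Fin s → ℂ[X]) (hA0 : ∀ e, (A e).coeff 0 = 1) (hB0 : ∀ e, (B e).coeff 0 = 1) (hAD : ∀ e, (A e).natDegree ≤ D) (hBD : ∀ e, (B e).natDegree ≤ D) (oA oB : Fin s → ℕ) (hoA : ∀ e, Active (A e) → IsOrder (A e) (oA e)) (hoB : ∀ e, Active (B e) → IsOrder (B e) (oB e)) (e₁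 : Fin s) (hA1 : Active (A e₁)) (h1min : ∀ e, Active (A e) → (oA e₁ : ℝ) * wt w (E e₁) ≤ (oA e : ℝ) * wt w (E e)) (a : ℂ) (ha : a ≠ 0) (v : Fin 2 → ℤ) (hv0 : v ≠ 0) (hoff : ¬ OnRay E v) (hv : fibreSum E D 1 0 A A v - a * fibreSum E D 1 0 B B (v - (oA e₁ : ℤ) • E e₁) ≠ 0) (hcanc : ∀ z, z ≠ 0 → wt w z < wt w v → fibreSum E D 1 0 A A z - a * fibreSum E D 1 0 B B (z - (oA e₁ : ℤ) • E e₁) = 0) : ∃ e' : Fin s, e' ≠ e₁ ∧ Active (B e') ∧ (v = (oA e₁ : ℤ) • E e₁ + (oB e' : ℤ) • E e' ∨ OnRay E ((oA e₁ : ℤ) • E e₁ + (oB e' : ℤ) • E e')) :=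
  deep_lemma E w hw hgen hE A B hA0 hB0 hAD hBD oA oB hoA hoB e₁ hA1 h1min a ha v hv0 hoff hv hcanc

end Summit.ValiantsHypothesis.ValiantsHypothesis.Theorems.NewtonTauWeakK3Paper

end
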